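import HarnessLib
import Summits.HodgeConjecture.HodgeConjecture.Cruxes.H413.Lines.K2_E3_EllipticInputs   -- tier 0 (namespace ∕ opens of record; Lines→Lines import, statements only)
import Summits.HodgeConjecture.HodgeConjecture.Theorems.K2E3GL3OneLinkNestedHigh        -- ★ p861011 (architect K2E3-p25 g3, D129 = D124 FILE 3): the C1″ PAYER `sAprimeC1high_of (hIRR) (hNYA) (hS0)`; its three binders ARE the sockets below
import Summits.HodgeConjecture.HodgeConjecture.Theorems.K2E3GL3NoWeightAlone                -- ★ p861271 (K2E3-p03 g8) `noWeightAAlone` ∕ `noWeightYAlone` UNCONDITIONAL   [ED. 2]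
import Summits.HodgeConjecture.HodgeConjecture.Theorems.K2E3GL3OneLinkNestedHighQuotient     -- ★ (K2E3-p27 g0) D124 FILE 2 «S0IRR» `isIrreducible_quotient`   [ED. 2]
import Summits.HodgeConjecture.HodgeConjecture.Theorems.K2E3GL3OneLinkNestedHighIrreducible  -- ★ p861185 (K-chain) IRR″ `isIrreducible_D_high`   [ED. 2]
import Summits.HodgeConjecture.HodgeConjecture.Theorems.K2E3GL3PrincipalSeriesThreeCell      -- ★ (CELL-3) `principalSeriesThreeCell`   [ED. 2]

/-!
# K2_E3_EllipticInputs ∕ U12Characters — PART «GL3» (tier 1): the LETTER SOCKETS of the `GL₃` case bricks of the (nsc-S-A′) re-cut (U12 MAIN §11-3), hosted apart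
(MAIN is 191 kB of a 200 kB workfile cap; the C1′ letters join here later).

WHY (K2E3-plan g4, ED. 1, 2026-09-04 ≈14:45Z).  ★ p861011 `K2E3GL3OneLinkNestedHigh.sAprimeC1high_of (hIRR) (hNYA) (hS0) : ‹(S-A′-C1″) body›` (architect K2E3-p25 (g3)) pays the MAIN
case socket C1″ `sig_K2E3GL3SAprimeC1high` MODULO THREE NAMED LETTERS.  This PART hosts the three letters as sockets — texts = the three binder types of ★ p861011 VERBATIM
(bracket-extracted from the tree file), each ∀-closed over EXACTLY the C1″ socket prefix `∀ (F : Type) [Field F] [ValuativeRel F] [TopologicalSpace F] [IsNonarchimedeanLocalField F]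
[CharZero F],` — so that MAIN ED. 38 ties C1″ BY NAME: `fun F _ _ _ _ _ => K2E3GL3OneLinkNestedHigh.sAprimeC1high_of (IRR″ F) (NYA F) (S0IRR″ F)` (REL over exactly these three).

CONTENT.  (C1″-IRR) `sig_K2E3GL3NestedHighIrreducible` — IRR″: the P₂₁-standard module `D″(η) = Ind(η∘det ⊗ (η·ν½)∘det)` on the `(2,1)` parabolic is IRREDUCIBLE for every `η` with open
kernel (K2E3-p17 (g9) Kill chain (K-a) ★ p860816 ∕ (K-b) p860979 ∕ (K-c) → `isIrreducible_D_high (η) (hη) (h3cell)`, fed (CELL-3) ★ at the tie) · (C1″-NYA) `sig_K2E3GL3NestedHighNoWeightYAlone`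
— NYA: no admissible irreducible `r` of `GL₃(F)` has normalized Jacquet module supported on the single weight `Y = (ην½, ην½⁻¹, ην½)` with multiplicity 1 (K2E3-p17 (g9) NAA ∕ K2E3-p03
lineage (T)) · (C1″-S0) `sig_K2E3GL3NestedHighQuotientIrreducible` — S0IRR″: for every injective `Φ : D″(η) → I(X)(η)`, the quotient `I(X) ⁄ Φ(D″)` is irreducible (K2E3-p27 (g0) D124 FILE 2
`K2E3GL3OneLinkNestedHighQuotient.isIrreducible_quotient`, ETA ≈15:25Z, over NYA + (CELL-3)).  Sorries in THIS file = 0 (ED. 2: all three letters ★-TIED BY NAME; ED. 1 had 3).  Same namespace as MAIN; no `instance`, no `notation`, no axioms.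

HONEST LABEL: HC_CM is proved only modulo the 7 printed citations (2 remaining named inputs: hLiu418 = stmt-HodgeConjecture-24832, h413 = stmt-HodgeConjecture-24833) until rung 0
closes; a hosted socket is a by-name debt; REL ≠ ★; ACCOUNTING at MAIN ED. 38: C1″ (1 socket) → REL over these 3 letter sockets (E3 Lines +2, finer named currency).

§ EDITIONS (this PART).  ED. 1 (K2E3-plan g4; generator `K2/K2E3-plan/g4/mk_gl3_ed1.py`, binders from ★ p861011 tree file b9651fd7a73abc29): created.  ED. 2 (K2E3-plan g4, generator `mk_gl3_ed2.py`, base 59d05fba40a62ec5): IRR := ★ p861185, NYA := ★ p861271,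
S0 := ★ `K2E3GL3OneLinkNestedHighQuotient.isIrreducible_quotient` (recipes = K2E3-p03 (g8) `Probe_C1_ties.lean`, FQ-spelled); + 4 imports; sorries 3 → 0; statements byte-identical (script-asserted).
-/

open NumberField IsDedekindDomain MeasureTheory
open scoped Matrix MatrixGroups Valued NNReal
open Literature.NumberTheory.Rogawski1990 Literature.NumberTheory.Automorphic Literature.NumberTheory.Automorphic.UnitaryGroup
open Literature.NumberTheory.Automorphic.UnitaryGroup.CotangentForms Literature.NumberTheory.GaloisRepresentations
open Literature.NumberTheory.Automorphic.Arthur2013.Leaves.TECR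
open Summit.HodgeConjecture.HodgeConjecture.Cruxes.H413.F0P3cStCharTSPaydown

namespace Summit.HodgeConjecture.HodgeConjecture.Cruxes.H413.K2E3EllipticInputs.U12Characters

/-! ## §G1 (ED. 1) — the three letters of the C1″ payer ★ p861011 `K2E3GL3OneLinkNestedHigh.sAprimeC1high_of` -/

set_option maxHeartbeats 1600000 in
set_option synthInstance.maxHeartbeats 400000 in
open MeasureTheory.Measure Set Filter Topology in
open Literature.NumberTheory.GaloisRepresentations.IsNonarchimedeanLocalField in
open scoped ENNReal in
/-- **LEAF (C1″-IRR) `sig_K2E3GL3NestedHighIrreducible`** (ED. 2: **★-TIED BY NAME** := ★ p861185 `K2E3GL3OneLinkNestedHighIrreducible.isIrreducible_D_high η hη (principalSeriesThreeCell F _)` — K2E3-p17 (K-chain) ∕ K2E3-p03 (g8) probe GREEN; statement FROZEN) — IRR″: for every quasi-character `η` of `Fˣ` with open kernel, the standard module `D″(η) = Ind_{P_(2,1)}^{GL₃}(η∘det ⊠ (η·ν½)∘det)` (★ STD-EMB spelling, = the `hIRR` binder of ★ p861011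
VERBATIM) is irreducible (Zelevinsky: the two segments `[ην⁻½, ην½]`, `{ην½}`… are NOT linked in the irreducibility-violating direction — Bernstein–Zelevinsky criterion).  PAYER: K2E3-p17 (g9)
`isIrreducible_D_high (η) (hη) (h3cell)` (Kill chain), tie feeds `sig_K2E3GL3PrincipalSeriesThreeCell F` for `h3cell`.  Size: M–L.
[cite: Zelevinsky1980, Thm. 4.2 p. 184, Thm. 6.1, Ex. 3.2] [cite: BernsteinZelevinsky1977, §2.3, Thm. 2.9]  STATE: ★-tied (ED. 2; was OPEN). -/
theorem sig_K2E3GL3NestedHighIrreducible : ∀ (F : Type) [Field F] [ValuativeRel F] [TopologicalSpace F] [IsNonarchimedeanLocalField F] [CharZero F],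
   ∀ η : Fˣ →* ℂˣ, IsOpen ((η.ker : Subgroup Fˣ) : Set Fˣ) → (Representation.parabolicIndGL F (![false, false, true] : Fin 3 → Bool) ((Representation.trivial ℂ (Π a : Bool, GL {i : Fin 3 // (![false, false, true] : Fin 3 → Bool) i = a} F) ℂ).twist ((η.comp (Matrix.GeneralLinearGroup.det.comp (Pi.evalMonoidHom (fun a : Bool => GL {i : Fin 3 // (![false, false, true] : Fin 3 → Bool) i = a} F) false))) * ((η * ((unramifiedTwist F (1 / 2) : QuasiChar F).toMonoidHom)).comp (Matrix.GeneralLinearGroup.det.comp (Pi.evalMonoidHom (fun a : Bool => GL {i : Fin 3 // (![false, false, true] : Fin 3 → Bool) i = a} F) true)))))).IsIrreducible :=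
  fun F _ _ _ _ _ η hη => K2E3GL3OneLinkNestedHighIrreducible.isIrreducible_D_high η hη (K2E3GL3PrincipalSeriesThreeCell.principalSeriesThreeCell F _)

set_option maxHeartbeats 1600000 in
set_option synthInstance.maxHeartbeats 400000 in
open MeasureTheory.Measure Set Filter Topology in
open Literature.NumberTheory.GaloisRepresentations.IsNonarchimedeanLocalField in
open Module in
open scoped ENNReal in
/-- **LEAF (C1″-NYA) `sig_K2E3GL3NestedHighNoWeightYAlone`** (ED. 2: **★-TIED BY NAME** := ★ p861271 `K2E3GL3NoWeightAlone.noWeightYAlone` (K2E3-p03 (g8): NAA + NYA UNCONDITIONAL ★); statement FROZEN) — NYA («no `Y` alone»): no admissible irreducible smooth `r` of `GL₃(F)` has normalized Jacquet module with the weight `Y(η) = (ην½, ην½⁻¹, ην½)` of multiplicity exactly `1` and every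
other weight absent (= the `hNYA` binder of ★ p861011 VERBATIM up to qualifying `restrictUnipotentGL` ↦ `Representation.restrictUnipotentGL`, the MAIN spelling, same constant): such an `r` would embed in `I(Y)` (★ EMB) whose constituents all carry a second weight (geometric lemma ∕ exponent
tables of ★ F7a `K2E3GL3OneLinkNestedHighAmbient`).  PAYER: K2E3-p17 (g9) NAA, or K2E3-p03 (g8) via (T) ★ F6 p860793.  Size: M.
[cite: Zelevinsky1980, §1.5, Thm. 6.1] [cite: BernsteinZelevinsky1977, Thm. 2.9, §2.5]  STATE: ★-tied (ED. 2; was OPEN). -/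
theorem sig_K2E3GL3NestedHighNoWeightYAlone : ∀ (F : Type) [Field F] [ValuativeRel F] [TopologicalSpace F] [IsNonarchimedeanLocalField F] [CharZero F],
   ∀ η : Fˣ →* ℂˣ, IsOpen ((η.ker : Subgroup Fˣ) : Set Fˣ) → ∀ (r : SmoothIrrep (GL (Fin 3) F)), r.ρ.IsAdmissible → ∀ [FiniteDimensional ℂ (Representation.restrictUnipotentGL F (id : Fin 3 → Fin 3) r.ρ).Coinvariants],
      finrank ℂ ↥(⨅ m, Module.End.maxGenEigenspace (Representation.normalizedJacquetGL F (id : Fin 3 → Fin 3) r.ρ m) (((∏ a : Fin 3, ((![(η * ((unramifiedTwist F (1 / 2) : QuasiChar F).toMonoidHom)), (η * ((unramifiedTwist F (1 / 2) : QuasiChar F).toMonoidHom)⁻¹), (η * ((unramifiedTwist F (1 / 2) : QuasiChar F).toMonoidHom))] : Fin 3 → (Fˣ →* ℂˣ)) a).comp (Matrix.GeneralLinearGroup.det.comp (Pi.evalMonoidHom (fun a : Fin 3 => GL {i : Fin 3 // (id : Fin 3 → Fin 3) i = a} F) a))) m : ℂˣ) : ℂ)) = 1 →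
      (∀ ζ : (Π a : Fin 3, GL {i : Fin 3 // (id : Fin 3 → Fin 3) i = a} F) → ℂ, ζ ≠ (fun m : (Π a : Fin 3, GL {i : Fin 3 // (id : Fin 3 → Fin 3) i = a} F) => (((∏ a : Fin 3, ((![(η * ((unramifiedTwist F (1 / 2) : QuasiChar F).toMonoidHom)), (η * ((unramifiedTwist F (1 / 2) : QuasiChar F).toMonoidHom)⁻¹), (η * ((unramifiedTwist F (1 / 2) : QuasiChar F).toMonoidHom))] : Fin 3 → (Fˣ →* ℂˣ)) a).comp (Matrix.GeneralLinearGroup.det.comp (Pi.evalMonoidHom (fun a : Fin 3 => GL {i : Fin 3 // (id : Fin 3 → Fin 3) i = a} F) a))) m : ℂˣ) : ℂ)) → finrank ℂ ↥(⨅ m, Module.End.maxGenEigenspace (Representation.normalizedJacquetGL F (id : Fin 3 → Fin 3) r.ρ m) (ζ m)) = 0) → False :=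
  fun _ _ _ _ _ _ => K2E3GL3NoWeightAlone.noWeightYAlone

set_option maxHeartbeats 1600000 in
set_option synthInstance.maxHeartbeats 400000 in
open MeasureTheory.Measure Set Filter Topology in
open Literature.NumberTheory.GaloisRepresentations.IsNonarchimedeanLocalField in
open scoped ENNReal in
/-- **LEAF (C1″-S0) `sig_K2E3GL3NestedHighQuotientIrreducible`** (ED. 2: **★-TIED BY NAME** := ★ `K2E3GL3OneLinkNestedHighQuotient.isIrreducible_quotient η hη (principalSeriesThreeCell F _) (noWeightYAlone η hη) Φ hΦ` — K2E3-p27 (g0) D124 FILE 2 «S0IRR» + ★ NYA + ★ (CELL-3); K2E3-p03 (g8) probe GREEN; statement FROZEN) — S0IRR″: for every `η` with open kernel and every INJECTIVE intertwiner `Φ : D″(η) → I(X)(η)` (`I(X)(η) = Ind_B(ην½⁻¹, ην½, ην½)`), the quotient `I(X)(η) ⁄ Φ(D″(η))` is irreducible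
(= the `hS0` binder of ★ p861011 VERBATIM; JH(I(X)) has length 2 with `D″` the unique sub of weight `X` — multiplicity count `mult I(X) = (2,…)` of ★ F7a + NYA).  PAYER: K2E3-p27 (g0)
D124 FILE 2 `K2E3GL3OneLinkNestedHighQuotient.isIrreducible_quotient (η) (hη) (h3cell) (hNYA) (Φ) (hΦ)` (architect recipe 14:36:37Z).  Size: M–L.
[cite: Zelevinsky1980, Thm. 6.1, §2] [cite: BernsteinZelevinsky1977, Thm. 2.9]  STATE: ★-tied (ED. 2; was OPEN). -/
theorem sig_K2E3GL3NestedHighQuotientIrreducible : ∀ (F : Type) [Field F] [ValuativeRel F] [TopologicalSpace F] [IsNonarchimedeanLocalField F] [CharZero F],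
   ∀ η : Fˣ →* ℂˣ, IsOpen ((η.ker : Subgroup Fˣ) : Set Fˣ) →
      ∀ (Φ : (Representation.parabolicIndGL F (![false, false, true] : Fin 3 → Bool) ((Representation.trivial ℂ (Π a : Bool, GL {i : Fin 3 // (![false, false, true] : Fin 3 → Bool) i = a} F) ℂ).twist ((η.comp (Matrix.GeneralLinearGroup.det.comp (Pi.evalMonoidHom (fun a : Bool => GL {i : Fin 3 // (![false, false, true] : Fin 3 → Bool) i = a} F) false))) * ((η * ((unramifiedTwist F (1 / 2) : QuasiChar F).toMonoidHom)).comp (Matrix.GeneralLinearGroup.det.comp (Pi.evalMonoidHom (fun a : Bool => GL {i : Fin 3 // (![false, false, true] : Fin 3 → Bool) i = a} F) true)))))).IntertwiningMap (Representation.parabolicIndGL F (id : Fin 3 → Fin 3) ((Representation.trivial ℂ (Π a : Fin 3, GL {i : Fin 3 // (id : Fin 3 → Fin 3) i = a} F) ℂ).twist (∏ a : Fin 3, ((![(η * ((unramifiedTwist F (1 / 2) : QuasiChar F).toMonoidHom)⁻¹), (η * ((unramifiedTwist F (1 / 2) : QuasiChar F).toMonoidHom)), (η * ((unramifiedTwist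 F (1 / 2) : QuasiChar F).toMonoidHom))] : Fin 3 → (Fˣ →* ℂˣ)) a).comp (Matrix.GeneralLinearGroup.det.comp (Pi.evalMonoidHom (fun a : Fin 3 => GL {i : Fin 3 // (id : Fin 3 → Fin 3) i = a} F) a)))))) (hΦ : Function.Injective Φ), (Φ.range.quotientRep).IsIrreducible :=
  fun F _ _ _ _ _ η hη Φ hΦ => K2E3GL3OneLinkNestedHighQuotient.isIrreducible_quotient η hη (K2E3GL3PrincipalSeriesThreeCell.principalSeriesThreeCell F _) (K2E3GL3NoWeightAlone.noWeightYAlone η hη) Φ hΦ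

end Summit.HodgeConjecture.HodgeConjecture.Cruxes.H413.K2E3EllipticInputs.U12Characters
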